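import Summits.HodgeConjecture.HodgeConjecture.Theorems.K2E3UnitaryLayerCharacters               -- ★ p855984 (this seat): (Char-U) `θ_J`-eigen bookkeeping, twisted invisibility, defect arithmetic
import Summits.HodgeConjecture.HodgeConjecture.Theorems.K2E3CongruenceLayerCharacterSurjectiveGL -- ★ p855619 (this seat): (S) GL `exists_valBound_and_forall_eq_map_trace`
import Literature.GroupTheory.FiniteAbelian.UnitAddCircleDuality                                 -- ★ `exists_addEquiv_unitAddCircle_additive_circle` (`ℝ/ℤ ≃+ Additive Circle`)
import Mathlib.Algebra.Category.Grp.Injective                                                    -- `Module.Baer.of_divisible` (a divisible group is an injective `ℤ`-module)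
import Mathlib.GroupTheory.Abelianization.Defs
import HarnessLib

/-!
# Crux `H413` — K2-LIT E3 «EllipticInputs», U12-h engine (Char-U, part 2 = S-U): EVERY CHARACTER OF A UNITARY CONGRUENCE LAYER IS `χ_X` WITH `X` IN THE `θ_J`-EIGENSPACE `𝔰_ε` —
# `χ` a character of `U(σ,J) ∩ K_{N′}` trivial on `U ∩ K_N` (`N′ ≤ N`, `N + d_S ≤ 2N′`) ⇒ `∃ X, θ_J X = ε•X ∧ χ(a) = ψ(tr(X(a − 1)))` on `U ∩ K_{N′}`: the brick `hS` (with `S := 𝔰_ε`) of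
# ★ p855958 `K2E3LevelTraceStableAtPlaceU.exists_levelTraceStable_U`; by CHARACTER EXTENSION `U`-layer → `GL`-layer (Baer: `ℝ/ℤ` is divisible, no finiteness needed), ★ (S) GL
# duality, and the `𝔰_ε`-PROJECTION `X := ½(X₀ + ε θ_J X₀)` (the complementary part is invisible on `𝔲` and integral against the quadratic part of a unitary layer element)

Cell `hodgecm-mathlib`, Track B «K2-LIT», crux item `stmt-HodgeConjecture-24833` (h413), line `K2_E3_EllipticInputs`, unit U12 «HC characters», socket U12-h
`sig_K2E3CharLocConstNearRegular` (‹#9L›), depth-halving road, non-split transport (memo v4 (Char-U); docking target K2E3-p09 (g2) ★ p855958 `hS`); seat K2E1b-p08 (g2); `--supports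
stmt-HodgeConjecture-24833 --as helper`.  THEOREMS ONLY — no `def`, no named fact, no instance, no notation, no `sorry`.  §1 is pure group theory (any group `G`); §2 pure matrix algebra
over a field; §3 over a non-archimedean local field `E` (★ (S) GL).  THE REGIME DEFECT `d_S` (`(v(⅟2)·max(1,κ′κ))²·|ϖ|^{d_S} ≤ 1`; `d_S = 0` at an unramified place with `J` unimodular
and `2 ∈ 𝒪^×`): the projection costs `v(⅟2)·max(1,κ′κ)` twice against the regime slack `|ϖ|^{2N′−N}`; in the tight regime `N ≤ 2N′` only SQUARES of characters are exactly
`𝔰_ε`-represented (`X₀ + εθX₀` represents `χ²`), which is why `hS` is asked in the regime `N + d_S ≤ 2N′` (K2 bus 2026-09-04T00:1xZ, request `depthHalving_defect₂`).  HONEST LABEL: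
HC_CM is proved only modulo the 7 printed citations (2 remaining named inputs: hLiu418 = stmt-HodgeConjecture-24832, h413 = stmt-HodgeConjecture-24833) until rung 0 closes; count-neutral.

THE MATHEMATICS [HarishChandra1999, §17 Thm. 17.1; Serre1977, §8.1 (characters of abelian groups extend: `ℝ/ℤ` divisible); Weyl1939, Ch. II §10; PlatonovRapinchuk1994, §3.3].
(§1 `exists_character_extension`) `K ≤ K′ ≤ G` with `[K′,K′] ⊆ K`, `U ≤ G`, `χ` multiplicative on `U ∩ K′` and trivial on `U ∩ K`: in the abelian group `B := K′ᵃᵇ ⧸ im(K)` the image of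
`U ∩ K′` is `(U ∩ K′)⧸ker`, and `ker ⊆ U ∩ K` (an element of `U ∩ K′` dying in `B` lies in `K·[K′,K′] ⊆ K`), so `χ` lives on a subgroup of `B` and extends to `B` by injectivity of `ℝ/ℤ`
(Mathlib `Module.Baer.of_divisible`); pulled back: `χ′` multiplicative on `K′`, trivial on `K`, `= χ` on `U ∩ K′`.  (§3 `exists_eigen_param_of_unitary_character`) ★ (S) GL gives `X₀` with
`v(X₀) ≤ |ϖ|^{−N}` and `χ′ = χ_{X₀}` on `K_{N′}`; `X := ½(X₀ + εθX₀) ∈ 𝔰_ε`, `X₀ − X = X^c` with `θX^c = −εX^c`; for `a ∈ U ∩ K_{N′}`, `W = a − 1 = W⁻ + W⁺`: `tr(X^cW⁻)` is KILLED by `ψ`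
(twisted invisibility, eigenvalues `(−ε)(−1) = ε`) and `tr(X^cW⁺)` is INTEGRAL (`W⁺ = −½θW·W` by ★ second-order unitarity: `v ≤ v(½)μ|ϖ|^{2N′}` against `v(X^c) ≤ v(½)μ|ϖ|^{−N}`,
regime `N + d_S ≤ 2N′`), so `χ(a) = χ_{X₀}(a) = χ_X(a)`.  §3 also carries the `ℂ`-valued adapter and the HEIGHT LEMMA `exists_valBound_pow_inv` (every matrix over `E` has a height —
the `L₀` of ★ (Char-U)).

## References
* [HarishChandra1999] Harish-Chandra (DeBacker–Sally), *Admissible Invariant Distributions on Reductive p-adic Groups*, ULECT 16 (1999), §17 Thm. 17.1.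
* [Serre1977] J.-P. Serre, *Linear Representations of Finite Groups*, GTM 42 (1977), §8.1.
* [Weyl1939] H. Weyl, *The Classical Groups* (1939), Ch. II §10.
* [PlatonovRapinchuk1994] V. Platonov, A. Rapinchuk, *Algebraic Groups and Number Theory* (1994), §2.3, §3.3.
-/

set_option autoImplicit false
-- the mandated namespace repeats `HodgeConjecture.HodgeConjecture`, as in every `Theorems/*.lean` of this sub-problem
set_option linter.dupNamespace false

noncomputable section

open scoped MatrixGroups Matrix
open ValuativeRel Literature.NumberTheory.Automorphic Literature.LinearAlgebra.Matrix

namespace Summit.HodgeConjecture.HodgeConjecture.Cruxes.H413.K2E3UnitaryLayerCharacterSurjective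

/-! ## §1 Character extension from `U ∩ K′` to `K′`, killing `K` (pure group theory) -/

section Extension

variable {G : Type*} [Group G]

/-- **CHARACTER EXTENSION.**  `K ≤ K′` subgroups of a group `G` with all commutators of `K′` in `K`, `U ≤ G`, `χ : G → S¹` multiplicative on `U ∩ K′` and trivial on `U ∩ K`.  Then there is
`χ′ : G → S¹` multiplicative on `K′`, trivial on `K`, and equal to `χ` on `U ∩ K′` — characters of the subgroup `(U ∩ K′)⧸(U ∩ K) ↪ K′⧸K` of an abelian group extend (injectivity of
the divisible group `ℝ/ℤ`, Mathlib `Module.Baer.of_divisible`; no finiteness needed). [cite: Serre1977, §8.1] -/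
theorem exists_character_extension (K' K U : Subgroup G) (hKK' : K ≤ K') (hcomm : ∀ a ∈ K', ∀ b ∈ K', a * b * a⁻¹ * b⁻¹ ∈ K) (χ : G → Circle)
    (hmul : ∀ a ∈ U, a ∈ K' → ∀ b ∈ U, b ∈ K' → χ (a * b) = χ a * χ b) (htriv : ∀ a ∈ U, a ∈ K → χ a = 1) :
    ∃ χ' : G → Circle, (∀ a ∈ K', ∀ b ∈ K', χ' (a * b) = χ' a * χ' b) ∧ (∀ a ∈ K, χ' a = 1) ∧ ∀ a ∈ U, a ∈ K' → χ' a = χ a := by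
  classical
  -- the abelian group `B := K'ᵃᵇ ⧸ im(K)` and the projection `mkB : K' → B`
  set NK : Subgroup (Abelianization ↥K') := (K.subgroupOf K').map Abelianization.of with hNK
  set mkB : ↥K' →* Abelianization ↥K' ⧸ NK := (QuotientGroup.mk' NK).comp Abelianization.of with hmkB
  have hmkB_K : ∀ k : ↥K', (k : G) ∈ K → mkB k = 1 := fun k hk => by
    rw [hmkB, MonoidHom.comp_apply, QuotientGroup.mk'_apply, QuotientGroup.eq_one_iff]
    exact Subgroup.mem_map_of_mem _ (Subgroup.mem_subgroupOf.2 hk)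
  -- `χ` as a homomorphism on `U ⊓ K'`
  let χU : ↥(U ⊓ K') →* Circle :=
    { toFun := fun a => χ a
      map_one' := htriv 1 U.one_mem K.one_mem
      map_mul' := fun a b => hmul a a.2.1 a.2.2 b b.2.1 b.2.2 }
  have hχU : ∀ a : ↥(U ⊓ K'), χU a = χ a := fun a => rfl
  set φ : ↥(U ⊓ K') →* Abelianization ↥K' ⧸ NK := mkB.comp (Subgroup.inclusion inf_le_right) with hφ
  have hφ_apply : ∀ a : ↥(U ⊓ K'), φ a = mkB ⟨a, a.2.2⟩ := fun a => rfl
  -- `ker φ ≤ ker χU`: an element of `U ∩ K'` dying in `B` lies in `K·[K', K'] ⊆ K`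
  have hcomm' : commutator ↥K' ≤ K.subgroupOf K' := by
    rw [commutator_def, Subgroup.commutator_le]
    intro p _ q _
    rw [commutatorElement_def, Subgroup.mem_subgroupOf, Subgroup.coe_mul, Subgroup.coe_mul, Subgroup.coe_mul, Subgroup.coe_inv, Subgroup.coe_inv]
    exact hcomm _ p.2 _ q.2
  have hker : φ.ker ≤ χU.ker := by
    intro a ha
    rw [MonoidHom.mem_ker] at ha ⊢
    rw [hφ_apply, hmkB, MonoidHom.comp_apply, QuotientGroup.mk'_apply, QuotientGroup.eq_one_iff, hNK, Subgroup.mem_map] at ha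
    obtain ⟨k, hk, hka⟩ := ha
    have h1 : k⁻¹ * ⟨(a : G), a.2.2⟩ ∈ commutator ↥K' := by
      rw [← Abelianization.ker_of, MonoidHom.mem_ker, map_mul, map_inv, hka, inv_mul_cancel]
    have h2 := hcomm' h1
    rw [Subgroup.mem_subgroupOf, Subgroup.coe_mul, Subgroup.coe_inv] at h2
    have h3 : (a : G) ∈ K := by
      have h := K.mul_mem (Subgroup.mem_subgroupOf.1 hk) h2
      rwa [mul_inv_cancel_left] at h
    rw [hχU]; exact htriv a a.2.1 h3
  -- the character `g` on `range φ ≅ (U ⊓ K') ⧸ ker φ`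
  let g : ↥φ.range →* Circle := (QuotientGroup.lift φ.ker χU hker).comp (QuotientGroup.quotientKerEquivRange φ).symm.toMonoidHom
  have hg : ∀ a : ↥(U ⊓ K'), g ⟨φ a, ⟨a, rfl⟩⟩ = χ a := by
    intro a
    have he : (QuotientGroup.quotientKerEquivRange φ).symm ⟨φ a, ⟨a, rfl⟩⟩ = (a : ↥(U ⊓ K') ⧸ φ.ker) := by
      rw [MulEquiv.symm_apply_eq]; rfl
    show QuotientGroup.lift φ.ker χU hker ((QuotientGroup.quotientKerEquivRange φ).symm ⟨φ a, ⟨a, rfl⟩⟩) = χ a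
    rw [he, QuotientGroup.lift_mk, hχU]
  -- additive clothing and the Baer extension into the divisible group `ℝ/ℤ`
  obtain ⟨e, -⟩ := Literature.GroupTheory.FiniteAbelian.exists_addEquiv_unitAddCircle_additive_circle
  have hinj : Function.Injective (MonoidHom.toAdditive φ.range.subtype) := fun x y h => by
    simpa using h
  obtain ⟨hA, hhA⟩ := (Module.Baer.of_divisible UnitAddCircle).extension_property_addMonoidHom
    (MonoidHom.toAdditive φ.range.subtype) hinj (e.symm.toAddMonoidHom.comp (MonoidHom.toAdditive g))
  let χB : Abelianization ↥K' ⧸ NK →* Circle := MonoidHom.toAdditive.symm (e.toAddMonoidHom.comp hA)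
  have hχB : ∀ b : ↥φ.range, χB b = g b := by
    intro b
    have h1 := DFunLike.congr_fun hhA (Additive.ofMul b)
    simp only [AddMonoidHom.coe_comp, Function.comp_apply, MonoidHom.toAdditive_apply_apply, toMul_ofMul, AddEquiv.coe_toAddMonoidHom,
      Subgroup.coe_subtype] at h1
    simp only [χB, MonoidHom.toAdditive_symm_apply_apply, AddMonoidHom.coe_comp, Function.comp_apply, AddEquiv.coe_toAddMonoidHom, h1,
      AddEquiv.apply_symm_apply, toMul_ofMul]
  -- the extension
  refine ⟨fun a => if ha : a ∈ K' then χB (mkB ⟨a, ha⟩) else 1, fun a ha b hb => ?_, fun a ha => ?_, fun a haU haK => ?_⟩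
  · simp only [dif_pos ha, dif_pos hb, dif_pos (K'.mul_mem ha hb), ← map_mul]; rfl
  · simp only [dif_pos (hKK' ha)]; rw [hmkB_K ⟨a, hKK' ha⟩ ha, map_one]
  · simp only [dif_pos haK]
    have h := hχB ⟨φ ⟨a, ⟨haU, haK⟩⟩, ⟨⟨a, ⟨haU, haK⟩⟩, rfl⟩⟩
    rw [hg] at h
    exact h

end Extension

/-! ## §2 `𝔰_ε`-projections (matrix algebra over a field with an involution `σ`, `J` hermitian with unit determinant, `2` invertible) -/

section Projection

variable {E : Type*} [Field E] {N : ℕ} (σ : E →+* E) {J : Matrix (Fin N) (Fin N) E} [Invertible (2 : E)]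

omit [Invertible (2 : E)] in
/-- For `ε = ±1`: `σ ε = ε` and `ε·ε = 1`. [folklore] -/
theorem map_eps_and_mul_self {ε : E} (hε : ε = 1 ∨ ε = -1) : σ ε = ε ∧ ε * ε = 1 := by
  rcases hε with rfl | rfl
  · exact ⟨map_one σ, one_mul 1⟩
  · exact ⟨by rw [map_neg, map_one], by rw [neg_mul_neg, one_mul]⟩

/-- **`X⁽ε⁾ := ½(X₀ + ε θX₀)` lies in `𝔰_ε`: `θ X⁽ε⁾ = ε • X⁽ε⁾`** (`θ` `σ`-semilinear involution ★, `σε = ε`, `ε² = 1`). [cite: PlatonovRapinchuk1994, §2.3] -/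
theorem formAdjoint_half_add_eps_smul {ε : E} (hε : ε = 1 ∨ ε = -1) (hσ : ∀ a : E, σ (σ a) = a) (hJ : (J.map σ)ᵀ = J) (hJu : IsUnit J.det)
    (X₀ : Matrix (Fin N) (Fin N) E) :
    J⁻¹ * ((⅟(2 : E) • (X₀ + ε • (J⁻¹ * (X₀.map σ)ᵀ * J))).map σ)ᵀ * J = ε • (⅟(2 : E) • (X₀ + ε • (J⁻¹ * (X₀.map σ)ᵀ * J))) := by
  obtain ⟨hσε, hε2⟩ := map_eps_and_mul_self σ hε
  rw [K2E3UnitaryLayerInvolution.formAdjoint_smul σ, K2E3UnitaryLayerInvolution.map_invOf_two σ, formAdjoint_add σ, K2E3UnitaryLayerInvolution.formAdjoint_smul σ, hσε,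
    K2E3UnitaryLayerInvolution.formAdjoint_formAdjoint σ hσ hJ hJu, smul_comm ε (⅟(2 : E))]
  congr 1
  rw [smul_add, smul_smul, hε2, one_smul, add_comm]

/-- … and the complementary part `X^c := ½(X₀ − ε θX₀)` has `θ X^c = (−ε) • X^c`. [cite: PlatonovRapinchuk1994, §2.3] -/
theorem formAdjoint_half_sub_eps_smul {ε : E} (hε : ε = 1 ∨ ε = -1) (hσ : ∀ a : E, σ (σ a) = a) (hJ : (J.map σ)ᵀ = J) (hJu : IsUnit J.det)
    (X₀ : Matrix (Fin N) (Fin N) E) :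
    J⁻¹ * ((⅟(2 : E) • (X₀ - ε • (J⁻¹ * (X₀.map σ)ᵀ * J))).map σ)ᵀ * J = (-ε) • (⅟(2 : E) • (X₀ - ε • (J⁻¹ * (X₀.map σ)ᵀ * J))) := by
  obtain ⟨hσε, hε2⟩ := map_eps_and_mul_self σ hε
  rw [K2E3UnitaryLayerInvolution.formAdjoint_smul σ, K2E3UnitaryLayerInvolution.map_invOf_two σ, formAdjoint_sub σ, K2E3UnitaryLayerInvolution.formAdjoint_smul σ, hσε,
    K2E3UnitaryLayerInvolution.formAdjoint_formAdjoint σ hσ hJ hJu, smul_comm (-ε) (⅟(2 : E))]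
  congr 1
  rw [smul_sub, smul_smul, neg_mul, hε2, neg_one_smul, sub_neg_eq_add, neg_smul, add_comm, ← sub_eq_add_neg]

omit [Invertible (2 : E)] in
/-- `X₀ = X⁽ε⁾ + X^c`. [folklore] -/
theorem eq_half_add_add_half_sub [Invertible (2 : E)] (X₀ T : Matrix (Fin N) (Fin N) E) : X₀ = ⅟(2 : E) • (X₀ + T) + ⅟(2 : E) • (X₀ - T) := by
  rw [add_comm]; exact K2E3UnitaryLayerInvolution.eq_half_sub_add_half_add X₀ T

variable {M : Type*} [CommMonoid M] (ψ : AddChar E M)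

omit [Invertible (2 : E)] in
/-- **TWISTED INVISIBILITY, two eigenvalues**: `θX = α•X`, `θP = β•P`, `αβ = ε`, `ψ` kills `{σ a = ε a}` ⇒ `ψ(tr(XP)) = 1`. [cite: HarishChandra1999, §17 p. 80] [cite: PlatonovRapinchuk1994, §2.3] -/
theorem map_trace_mul_eq_one_of_eigen₂ {ε α β : E} (hanti : ∀ a : E, σ a = ε * a → ψ a = 1) (hJu : IsUnit J.det) (hαβ : α * β = ε)
    {X P : Matrix (Fin N) (Fin N) E} (hX : J⁻¹ * (X.map σ)ᵀ * J = α • X) (hP : J⁻¹ * (P.map σ)ᵀ * J = β • P) : ψ (Matrix.trace (X * P)) = 1 :=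
  hanti _ (by rw [K2E3UnitaryLayerInvolution.map_trace_mul σ hJu, hX, hP, Matrix.smul_mul, Matrix.mul_smul, smul_smul, Matrix.trace_smul, smul_eq_mul, hαβ])

end Projection

/-! ## §3 Characters of unitary layers are `χ_X`, `X ∈ 𝔰_ε` (non-archimedean local field) -/

section Surjective

variable {E : Type*} [Field E] [ValuativeRel E] {N : ℕ} (σ : E →+* E) {J : Matrix (Fin N) (Fin N) E} {ϖ : E}

/-- `v(ε • Y) ≤ γ` for `ε = ±1`, `v(Y) ≤ γ`. [folklore] -/
theorem valBound_eps_smul {ε : E} (hε : ε = 1 ∨ ε = -1) {γ : ValueGroupWithZero E} {Y : Matrix (Fin N) (Fin N) E} (hY : ValBound γ Y) : ValBound γ (ε • Y) := by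
  rcases hε with rfl | rfl
  · rwa [one_smul]
  · rw [neg_one_smul]; exact hY.neg

/-- The parts `½(X₀ ± εθX₀)` of `X₀` with `v(X₀) ≤ γ` have `v ≤ v(⅟2)·max(1, κ′κ)·γ`. [cite: PlatonovRapinchuk1994, §2.3] -/
theorem valBound_half_add_sub_eps [Invertible (2 : E)] {ε : E} (hε : ε = 1 ∨ ε = -1) (hσv : ∀ a : E, valuation E (σ a) = valuation E a)
    {κ κ' γ : ValueGroupWithZero E} (hJb : ValBound κ J) (hJib : ValBound κ' J⁻¹) {X₀ : Matrix (Fin N) (Fin N) E} (hX₀ : ValBound γ X₀) :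
    ValBound (valuation E (⅟(2 : E)) * max 1 (κ' * κ) * γ) (⅟(2 : E) • (X₀ + ε • (J⁻¹ * (X₀.map σ)ᵀ * J))) ∧
      ValBound (valuation E (⅟(2 : E)) * max 1 (κ' * κ) * γ) (⅟(2 : E) • (X₀ - ε • (J⁻¹ * (X₀.map σ)ᵀ * J))) := by
  have h1 : ValBound (max 1 (κ' * κ) * γ) X₀ := hX₀.mono (le_mul_of_one_le_left' (le_max_left _ _))
  have h2 : ValBound (max 1 (κ' * κ) * γ) (ε • (J⁻¹ * (X₀.map σ)ᵀ * J)) :=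
    (valBound_eps_smul hε (K2E3UnitaryLayerCharacters.valBound_formAdjoint σ hσv hJb hJib hX₀)).mono
      (by rw [mul_assoc, mul_comm γ, ← mul_assoc]; exact mul_le_mul' (le_max_right _ _) le_rfl)
  rw [mul_assoc]
  exact ⟨K2E3UnitaryLayerCharacters.valBound_smul _ (h1.add h2), K2E3UnitaryLayerCharacters.valBound_smul _ (h1.sub h2)⟩

/-- **THE QUADRATIC PART OF A UNITARY LAYER ELEMENT**: for `a ∈ U(σ,J)` with `v(a − 1) ≤ γ`, `W := a − 1`: `W⁺ = ½(W + θW) = −½·θW·W` (★ second-order unitarity), so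
`v(W⁺) ≤ v(⅟2)·max(1,κ′κ)·(γ·γ)`. [cite: Weyl1939, Ch. II §10] [cite: PlatonovRapinchuk1994, §3.3] -/
theorem valBound_half_add_formAdjoint_of_mem [Invertible (2 : E)] (hσv : ∀ a : E, valuation E (σ a) = valuation E a) (hJu : IsUnit J.det)
    {κ κ' γ : ValueGroupWithZero E} (hJb : ValBound κ J) (hJib : ValBound κ' J⁻¹) {a : GL (Fin N) E} (haU : a ∈ unitaryGroupOfForm σ J)
    (ha : ValBound γ ((a : Matrix (Fin N) (Fin N) E) - 1)) :
    ValBound (valuation E (⅟(2 : E)) * max 1 (κ' * κ) * (γ * γ))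
      (⅟(2 : E) • (((a : Matrix (Fin N) (Fin N) E) - 1) + J⁻¹ * ((((a : Matrix (Fin N) (Fin N) E) - 1)).map σ)ᵀ * J)) := by
  rw [add_comm, K2E3UnitaryLayerInvolution.formAdjoint_sub_one_add_eq σ hJu haU, mul_assoc]
  refine K2E3UnitaryLayerCharacters.valBound_smul _ ?_
  have h := (K2E3UnitaryLayerCharacters.valBound_formAdjoint σ hσv hJb hJib ha).neg.mul ha
  exact h.mono (by rw [mul_right_comm κ' γ κ, mul_assoc (κ' * κ)]; exact mul_le_mul' (le_max_right _ _) le_rfl)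

variable [TopologicalSpace E] [IsNonarchimedeanLocalField E]

/-- **EVERY MATRIX HAS A HEIGHT**: `∃ L₀, v(X) ≤ |ϖ|^{−L₀}` (the `L₀` of ★ (Char-U); `𝒪` is a DVR with uniformizer `ϖ`). [folklore] -/
theorem exists_valBound_pow_inv (hϖ : IsUniformizingElement ϖ) (X : Matrix (Fin N) (Fin N) E) : ∃ L₀ : ℕ, ValBound (valuation E ϖ ^ L₀)⁻¹ X := by
  classical
  have hπ0 : 0 < valuation E ϖ := (Valuation.pos_iff _).2 hϖ.ne_zero
  have hirr : Irreducible (⟨ϖ, hϖ.mem⟩ : 𝒪[E]) :=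
    IsDiscreteValuationRing.irreducible_of_span_eq_maximalIdeal _ (fun h => hϖ.ne_zero (congrArg Subtype.val h)) hϖ.span_eq
  -- one entry
  have hentry : ∀ x : E, ∃ L : ℕ, valuation E x ≤ (valuation E ϖ ^ L)⁻¹ := by
    intro x
    by_cases hx : valuation E x ≤ 1
    · exact ⟨0, by rwa [pow_zero, inv_one]⟩
    push Not at hx
    have hx0 : x ≠ 0 := fun h => by rw [h, map_zero] at hx; exact not_lt.2 zero_le hx
    have hy : valuation E x⁻¹ ≤ 1 := by rw [map_inv₀]; exact inv_le_one_of_one_le₀ hx.le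
    have hy0 : (⟨x⁻¹, (Valuation.mem_integer_iff _ _).2 hy⟩ : 𝒪[E]) ≠ 0 := fun h => inv_ne_zero hx0 (congrArg Subtype.val h)
    obtain ⟨L, u, hu⟩ := IsDiscreteValuationRing.eq_unit_mul_pow_irreducible hy0 hirr
    have hu' : x⁻¹ = ((u : 𝒪[E]) : E) * ϖ ^ L := by
      have h := congrArg Subtype.val hu; simpa using h
    have hvu : valuation E ((u : 𝒪[E]) : E) = 1 := (Valuation.integer.integers (valuation E)).valuation_unit u
    refine ⟨L, ?_⟩
    have h : valuation E x⁻¹ = valuation E ϖ ^ L := by rw [hu', map_mul, hvu, one_mul, map_pow]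
    rw [map_inv₀] at h
    rw [← inv_inv (valuation E x), h]
  choose L hL using hentry
  refine ⟨∑ i, ∑ j, L (X i j), fun i j => (hL (X i j)).trans (inv_anti₀ (pow_pos hπ0 _) (pow_le_pow_right_of_le_one' hϖ.valuation_le_one ?_))⟩
  exact (Finset.single_le_sum (f := fun j => L (X i j)) (fun _ _ => Nat.zero_le _) (Finset.mem_univ j)).trans
    (Finset.single_le_sum (f := fun i => ∑ j, L (X i j)) (fun _ _ => Nat.zero_le _) (Finset.mem_univ i))

variable [Invertible (2 : E)] {ψ : AddChar E Circle}

/-- **EVERY CHARACTER OF A UNITARY LAYER IS `χ_X` WITH `X ∈ 𝔰_ε` (brick hS-U).**  `ψ` of conductor exactly `𝒪` killing `{σ a = ε a}` (`ε = ±1`), `σ` involutive isometric, `J`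
hermitian with unit determinant, `v(J) ≤ κ`, `v(J⁻¹) ≤ κ′`, regime defect `d_S` with `(v(⅟2)·max(1,κ′κ))²·|ϖ|^{d_S} ≤ 1`; levels `1 ≤ N′ ≤ N`, `N + d_S ≤ 2N′`; `χ : GL_N(E) → S¹`
multiplicative on `U(σ,J) ∩ K_{N′}` and trivial on `U ∩ K_N`.  THEN `∃ X`, **`θ_J X = ε•X`**, `v(X) ≤ v(⅟2)·max(1,κ′κ)·|ϖ|^{−N}`, and **`χ(a) = ψ(tr(X(a − 1)))` for all `a ∈ U ∩ K_{N′}`**.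
[cite: HarishChandra1999, §17 Thm. 17.1] [cite: Serre1977, §8.1] [cite: Weyl1939, Ch. II §10] -/
theorem exists_eigen_param_of_unitary_character (hϖ : IsUniformizingElement ϖ) (hψ : ∀ x : E, valuation E x ≤ 1 → ψ x = 1)
    (hψ' : ∃ x : E, valuation E x ≤ (valuation E ϖ)⁻¹ ∧ ψ x ≠ 1) {ε : E} (hε : ε = 1 ∨ ε = -1) (hanti : ∀ a : E, σ a = ε * a → ψ a = 1)
    (hσ : ∀ a : E, σ (σ a) = a) (hσv : ∀ a : E, valuation E (σ a) = valuation E a) (hJ : (J.map σ)ᵀ = J) (hJu : IsUnit J.det)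
    {κ κ' : ValueGroupWithZero E} (hJb : ValBound κ J) (hJib : ValBound κ' J⁻¹) {dS : ℕ}
    (hdS : valuation E (⅟(2 : E)) * max 1 (κ' * κ) * (valuation E (⅟(2 : E)) * max 1 (κ' * κ)) * valuation E ϖ ^ dS ≤ 1)
    {N' n : ℕ} (hN' : 1 ≤ N') (hle : N' ≤ n) (h2 : n + dS ≤ 2 * N') (χ : GL (Fin N) E → Circle)
    (hmul : ∀ a ∈ unitaryGroupOfForm σ J, a ∈ congruenceGL N (valuation E ϖ ^ N') → ∀ b ∈ unitaryGroupOfForm σ J, b ∈ congruenceGL N (valuation E ϖ ^ N') →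
      χ (a * b) = χ a * χ b)
    (htriv : ∀ a ∈ unitaryGroupOfForm σ J, a ∈ congruenceGL N (valuation E ϖ ^ n) → χ a = 1) :
    ∃ X : Matrix (Fin N) (Fin N) E, J⁻¹ * (X.map σ)ᵀ * J = ε • X ∧ ValBound (valuation E (⅟(2 : E)) * max 1 (κ' * κ) * (valuation E ϖ ^ n)⁻¹) X ∧
      ∀ a ∈ unitaryGroupOfForm σ J, a ∈ congruenceGL N (valuation E ϖ ^ N') → χ a = ψ (Matrix.trace (X * ((a : Matrix (Fin N) (Fin N) E) - 1))) := by
  have hπ1 := hϖ.valuation_le_one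
  have hπ0 : 0 < valuation E ϖ := (Valuation.pos_iff _).2 hϖ.ne_zero
  -- extend `χ` to a character `χ'` of `K_{N'}` trivial on `K_n`
  obtain ⟨χ', hmul', htriv', hagree⟩ := exists_character_extension (congruenceGL N (valuation E ϖ ^ N')) (congruenceGL N (valuation E ϖ ^ n))
    (unitaryGroupOfForm σ J) (congruenceGL_mono (pow_le_pow_right_of_le_one' hπ1 hle))
    (fun a ha b hb => commutator_mem_congruenceGL_of_mul_le (by rw [← pow_add]; exact pow_le_pow_right_of_le_one' hπ1 (by omega)) ha hb) χ
    (fun a haU haK b hbU hbK => hmul a haU haK b hbU hbK) (fun a haU haK => htriv a haU haK)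
  -- ★ (S) GL: `χ' = χ_{X₀}` on `K_{N'}`
  obtain ⟨X₀, hX₀b, hX₀⟩ := K2E3CongruenceLayerCharacterSurjectiveGL.exists_valBound_and_forall_eq_map_trace hϖ hψ hψ' hN' hle (by omega) χ' hmul' htriv'
  -- the `𝔰_ε`-projection
  obtain ⟨hXb, hXcb⟩ := valBound_half_add_sub_eps σ hε hσv hJb hJib hX₀b
  refine ⟨⅟(2 : E) • (X₀ + ε • (J⁻¹ * (X₀.map σ)ᵀ * J)), formAdjoint_half_add_eps_smul σ hε hσ hJ hJu X₀, hXb, fun a haU haK => ?_⟩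
  rw [← hagree a haU haK, hX₀ a haK]
  -- `χ_{X₀}(a) = χ_X(a) · χ_{X^c}(a)` and `χ_{X^c}(a) = 1`
  set W : Matrix (Fin N) (Fin N) E := (a : Matrix (Fin N) (Fin N) E) - 1 with hW
  have hXc : J⁻¹ * ((⅟(2 : E) • (X₀ - ε • (J⁻¹ * (X₀.map σ)ᵀ * J))).map σ)ᵀ * J = (-ε) • (⅟(2 : E) • (X₀ - ε • (J⁻¹ * (X₀.map σ)ᵀ * J))) :=
    formAdjoint_half_sub_eps_smul σ hε hσ hJ hJu X₀
  have hsplit := K2E3UnitaryLayerInvolution.eq_half_sub_add_half_add W (J⁻¹ * (W.map σ)ᵀ * J)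
  have hWm : J⁻¹ * ((⅟(2 : E) • (W - J⁻¹ * (W.map σ)ᵀ * J)).map σ)ᵀ * J = (-1 : E) • (⅟(2 : E) • (W - J⁻¹ * (W.map σ)ᵀ * J)) := by
    rw [neg_one_smul]; exact K2E3UnitaryLayerInvolution.formAdjoint_half_sub σ hσ hJ hJu W
  have hWpb := valBound_half_add_formAdjoint_of_mem σ hσv hJu hJb hJib haU haK.2.1
  -- `ψ(tr(X^c W⁻)) = 1` (eigenvalues `(−ε)(−1) = ε`) and `ψ(tr(X^c W⁺)) = 1` (integrality in the regime)
  have hkill : ψ (Matrix.trace (⅟(2 : E) • (X₀ - ε • (J⁻¹ * (X₀.map σ)ᵀ * J)) * (⅟(2 : E) • (W - J⁻¹ * (W.map σ)ᵀ * J)))) = 1 :=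
    map_trace_mul_eq_one_of_eigen₂ σ ψ hanti hJu (by rw [neg_mul_neg, mul_one]) hXc hWm
  have hint : ψ (Matrix.trace (⅟(2 : E) • (X₀ - ε • (J⁻¹ * (X₀.map σ)ᵀ * J)) * (⅟(2 : E) • (W + J⁻¹ * (W.map σ)ᵀ * J)))) = 1 := by
    refine K2E3CongruenceLayerCharactersGL.map_trace_mul_eq_one ψ hψ ?_ hXcb hWpb
    -- `(cμ (π^n)⁻¹) · (cμ π^{N'} π^{N'}) ≤ (cμ)² π^{dS} ≤ 1`
    have hreg : (valuation E ϖ ^ n)⁻¹ * (valuation E ϖ ^ N' * valuation E ϖ ^ N') ≤ valuation E ϖ ^ dS := by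
      rw [← pow_add, inv_mul_le_iff₀ (pow_pos hπ0 _), ← pow_add]
      exact pow_le_pow_right_of_le_one' hπ1 (by omega)
    calc valuation E (⅟(2 : E)) * max 1 (κ' * κ) * (valuation E ϖ ^ n)⁻¹ * (valuation E (⅟(2 : E)) * max 1 (κ' * κ) * (valuation E ϖ ^ N' * valuation E ϖ ^ N'))
          = valuation E (⅟(2 : E)) * max 1 (κ' * κ) * (valuation E (⅟(2 : E)) * max 1 (κ' * κ)) * ((valuation E ϖ ^ n)⁻¹ * (valuation E ϖ ^ N' * valuation E ϖ ^ N')) := by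
            simp only [mul_assoc, mul_left_comm]
      _ ≤ valuation E (⅟(2 : E)) * max 1 (κ' * κ) * (valuation E (⅟(2 : E)) * max 1 (κ' * κ)) * valuation E ϖ ^ dS := mul_le_mul' le_rfl hreg
      _ ≤ 1 := hdS
  conv_lhs => rw [eq_half_add_add_half_sub X₀ (ε • (J⁻¹ * (X₀.map σ)ᵀ * J)), Matrix.add_mul, Matrix.trace_add, AddChar.map_add_eq_mul]
  rw [show ψ (Matrix.trace (⅟(2 : E) • (X₀ - ε • (J⁻¹ * (X₀.map σ)ᵀ * J)) * W)) = 1 by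
    conv_lhs => rw [hsplit]
    rw [Matrix.mul_add, Matrix.trace_add, AddChar.map_add_eq_mul, hkill, hint, one_mul], mul_one]

/-- **`ℂ`-VALUED FORM** (the shape in which eigencharacters of a finite unitary layer on a complex representation arrive): `χ : GL_N(E) → ℂ` with `‖χ a‖ = 1` on `U ∩ K_{N′}`, multiplicative
there and trivial on `U ∩ K_N` ⇒ `∃ X ∈ 𝔰_ε`, `χ(a) = ψ(tr(X(a−1)))` (as a complex number) on `U ∩ K_{N′}`. [cite: HarishChandra1999, §17 Thm. 17.1] [cite: Serre1977, §8.1] -/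
theorem exists_eigen_param_of_unitary_character_complex (hϖ : IsUniformizingElement ϖ) (hψ : ∀ x : E, valuation E x ≤ 1 → ψ x = 1)
    (hψ' : ∃ x : E, valuation E x ≤ (valuation E ϖ)⁻¹ ∧ ψ x ≠ 1) {ε : E} (hε : ε = 1 ∨ ε = -1) (hanti : ∀ a : E, σ a = ε * a → ψ a = 1)
    (hσ : ∀ a : E, σ (σ a) = a) (hσv : ∀ a : E, valuation E (σ a) = valuation E a) (hJ : (J.map σ)ᵀ = J) (hJu : IsUnit J.det)
    {κ κ' : ValueGroupWithZero E} (hJb : ValBound κ J) (hJib : ValBound κ' J⁻¹) {dS : ℕ}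
    (hdS : valuation E (⅟(2 : E)) * max 1 (κ' * κ) * (valuation E (⅟(2 : E)) * max 1 (κ' * κ)) * valuation E ϖ ^ dS ≤ 1)
    {N' n : ℕ} (hN' : 1 ≤ N') (hle : N' ≤ n) (h2 : n + dS ≤ 2 * N') (χ : GL (Fin N) E → ℂ)
    (hmul : ∀ a ∈ unitaryGroupOfForm σ J, a ∈ congruenceGL N (valuation E ϖ ^ N') → ∀ b ∈ unitaryGroupOfForm σ J, b ∈ congruenceGL N (valuation E ϖ ^ N') →
      χ (a * b) = χ a * χ b)
    (htriv : ∀ a ∈ unitaryGroupOfForm σ J, a ∈ congruenceGL N (valuation E ϖ ^ n) → χ a = 1)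
    (hnorm : ∀ a ∈ unitaryGroupOfForm σ J, a ∈ congruenceGL N (valuation E ϖ ^ N') → ‖χ a‖ = 1) :
    ∃ X : Matrix (Fin N) (Fin N) E, J⁻¹ * (X.map σ)ᵀ * J = ε • X ∧ ValBound (valuation E (⅟(2 : E)) * max 1 (κ' * κ) * (valuation E ϖ ^ n)⁻¹) X ∧
      ∀ a ∈ unitaryGroupOfForm σ J, a ∈ congruenceGL N (valuation E ϖ ^ N') →
        χ a = ((ψ (Matrix.trace (X * ((a : Matrix (Fin N) (Fin N) E) - 1))) : Circle) : ℂ) := by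
  classical
  -- lift `χ` to the circle on `U ∩ K_{N'}` (value `1` elsewhere)
  let χc : GL (Fin N) E → Circle := fun k =>
    if h : k ∈ unitaryGroupOfForm σ J ∧ k ∈ congruenceGL N (valuation E ϖ ^ N') then ⟨χ k, mem_sphere_zero_iff_norm.2 (hnorm k h.1 h.2)⟩ else 1
  have hχc : ∀ k ∈ unitaryGroupOfForm σ J, k ∈ congruenceGL N (valuation E ϖ ^ N') → ((χc k : Circle) : ℂ) = χ k := fun k hk hk' => by
    simp only [χc, dif_pos (And.intro hk hk')]
  have hle' : congruenceGL N (valuation E ϖ ^ n) ≤ congruenceGL N (valuation E ϖ ^ N') := congruenceGL_mono (pow_le_pow_right_of_le_one' hϖ.valuation_le_one hle)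
  obtain ⟨X, hXu, hXb, hX⟩ := exists_eigen_param_of_unitary_character σ hϖ hψ hψ' hε hanti hσ hσv hJ hJu hJb hJib hdS hN' hle h2 χc
    (fun a haU haK b hbU hbK => Circle.ext (by
      rw [Circle.coe_mul, hχc a haU haK, hχc b hbU hbK, hχc (a * b) (Subgroup.mul_mem _ haU hbU) (Subgroup.mul_mem _ haK hbK)]
      exact hmul a haU haK b hbU hbK))
    (fun a haU haK => Circle.ext (by rw [hχc a haU (hle' haK), Circle.coe_one]; exact htriv a haU haK))
  exact ⟨X, hXu, hXb, fun a haU haK => by rw [← hχc a haU haK, hX a haU haK]⟩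

end Surjective

end Summit.HodgeConjecture.HodgeConjecture.Cruxes.H413.K2E3UnitaryLayerCharacterSurjective

end
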